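import Summits.QuantumFields.GaugeBoot.ClassBNegativeCouplingTwoDim
import HarnessLib

/-!
# In two dimensions Class T (the tilted class) is inhabited EXACTLY for `β ≥ 0`
(gauge-boot, task L3(α), tilted route)

HONEST FRAMING (cell `pub-gaugeboot`, page 1 of every file): the venture produces certified bounds
on lattice expectations at stated coupling, gauge group, dimension and torus size; NOT a mass gap,
NOT a continuum limit, NOT a string tension; NOT Yang–Mills-summit-bearing (barriers
`FixedCouplingUltralocality`, `PerturbativeInvisibility`). Structural; certifies no number.

## Content

`TiltedRP.TiltedClassState d i j ρ β` (`TiltedBoxLimitClass.lean`) keeps ONE diagonal reflection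
positivity (the plane `(i, j)`) together with translation invariance, the swap `(i j)`, the axis
reflections and the one-link Haar-shift identity; it is inhabited at every `β ≥ 0` in every
dimension (`TiltedRP.nonempty_tiltedClassState`, tilted boxes). In TWO dimensions (`∀ k, k = i ∨ k = j`)
the single diagonal mirror serves every plane, so the negative-coupling obstruction of
`ClassBNegativeCouplingEmpty.lean` applies:

* ★★★ **`TiltedRP.TiltedClassState.false_of_neg_two`** — `ρ` continuous (`N ≥ 1`) with a central
  scalar `ρ z = ω • 1`, `ω ≠ 1`, `β < 0`, `d = 2`: no Class-T state (diagonal RP for the reversed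
  pair `(j, i)` comes from the `(i, j)` one by conjugation with the swap symmetry of the state,
  `IsReflectionPositiveFor.of_conj`);
* ★★★ **`TiltedRP.nonempty_tiltedClassState_two_iff`** — `Nonempty (TiltedClassState d i j ρ β) ↔ 0 ≤ β`
  in two dimensions; `…_fin_two_iff_suN` / `_uN` on `ℤ²`.

NOT claimed: `d ≥ 3` at `β < 0` (the other planes through a link carry no diagonal RP in Class T;
the sign argument needs `u_p ≥ 0` in every plane through the link).
-/

open MeasureTheory

namespace Summit.QuantumFields.GaugeBoot

namespace TiltedRP

open Literature.MathematicalPhysics.QuantumLattice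

noncomputable section

variable {d N : ℕ} {i j : Fin d} {G : Type*} [Group G] [TopologicalSpace G] [IsTopologicalGroup G]
  [CompactSpace G] [MeasurableSpace G] [BorelSpace G] [SecondCountableTopology G]
  (ρ : G →* Matrix (Fin N) (Fin N) ℂ)

omit [IsTopologicalGroup G] [CompactSpace G] [BorelSpace G] [SecondCountableTopology G] in
/-- In two dimensions a Class-T state is diagonally reflection positive in EVERY ordered pair of
distinct axes (the given pair and, by conjugation with its swap symmetry, the reversed pair). -/
theorem TiltedClassState.diagRP_all_of_two (hij : i ≠ j) (hd : ∀ k : Fin d, k = i ∨ k = j) {β : ℝ}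
    (w : TiltedClassState d i j ρ β) (a b : Fin d) (hab : a ≠ b) :
    IsReflectionPositiveFor (configDiagSwapZd (G := G) a b) (diagHalfEdges a b) w.μ := by
  have hji : IsReflectionPositiveFor (configDiagSwapZd (G := G) j i) (diagHalfEdges j i) w.μ :=
    IsReflectionPositiveFor.of_conj w.swapInvariant DiagRP.measurable_configDiagSwapZd
      (configPerm_swap_configPerm_swap' i j) (configDiagSwapZd_eq_conj_swap i j)
      (dependsOn_comp_configPerm_swap_diagHalf i j) w.diagRP
  rcases hd a with rfl | rfl <;> rcases hd b with rfl | rfl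
  · exact absurd rfl hab
  · exact w.diagRP
  · exact hji
  · exact absurd rfl hab

/-- ★★★ **No Class-T state in two dimensions at `β < 0`** (`ρ` continuous, `N ≥ 1`, central scalar
`ρ z = ω • 1` with `ω ≠ 1`). -/
theorem TiltedClassState.false_of_neg_two [NeZero N] (hij : i ≠ j) (hd : ∀ k : Fin d, k = i ∨ k = j)
    (hρ : Continuous ρ) {z : G} {ω : ℂ} (hz : ρ z = ω • (1 : Matrix (Fin N) (Fin N) ℂ)) (hω : ω ≠ 1)
    {β : ℝ} (hβ : β < 0) (w : TiltedClassState d i j ρ β) : False := by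
  haveI := w.isProbabilityMeasure
  exact false_of_translationInvariant_haarShift_diagRP_of_neg ρ hρ hz hω (two_le_of_ne hij) hβ
    w.translationInvariant w.haarShift (TiltedClassState.diagRP_all_of_two ρ hij hd w)

/-- ★★★ **In two dimensions Class T is inhabited iff `β ≥ 0`** (`G` compact metrisable, `ρ`
continuous, `N ≥ 1`, central scalar `ω ≠ 1`; `i ≠ j` the two axes). -/
theorem nonempty_tiltedClassState_two_iff [NeZero N] [T2Space G] (hij : i ≠ j)
    (hd : ∀ k : Fin d, k = i ∨ k = j) (hρ : Continuous ρ) {z : G} {ω : ℂ}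
    (hz : ρ z = ω • (1 : Matrix (Fin N) (Fin N) ℂ)) (hω : ω ≠ 1) (β : ℝ) :
    Nonempty (TiltedClassState d i j ρ β) ↔ 0 ≤ β := by
  constructor
  · intro ⟨w⟩
    by_contra hβ
    exact TiltedClassState.false_of_neg_two ρ hij hd hρ hz hω (not_le.1 hβ) w
  · exact fun hβ => nonempty_tiltedClassState ρ hij hρ hβ

open Literature.MathematicalPhysics.QuantumFieldTheory in
/-- ★★★ **`SU(N)` on `ℤ²` (`N ≥ 2`): Class T is inhabited iff `β ≥ 0`.** -/
theorem nonempty_tiltedClassState_fin_two_iff_suN {N : ℕ} (hN : 2 ≤ N) (β : ℝ) :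
    Nonempty (TiltedClassState 2 (0 : Fin 2) 1 (fundamentalRep (Fin N)) β) ↔ 0 ≤ β := by
  haveI : NeZero N := ⟨by omega⟩
  haveI : SecondCountableTopology (Matrix (Fin N) (Fin N) ℂ) :=
    inferInstanceAs (SecondCountableTopology (Fin N → Fin N → ℂ))
  haveI : SecondCountableTopology (Matrix.specialUnitaryGroup (Fin N) ℂ) :=
    Topology.IsEmbedding.subtypeVal.secondCountableTopology
  obtain ⟨z, ζ, hζ1, hz, -⟩ := IsSpecialUnitaryModel.exists_central (fundamentalRep (Fin N))
    (TorusAreaLaw.isSpecialUnitaryModel_fundamentalRep N) hN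
  exact nonempty_tiltedClassState_two_iff (fundamentalRep (Fin N)) Fin.zero_ne_one
    (fun k => by fin_cases k <;> simp) (continuous_fundamentalRep (Fin N)) hz hζ1 β

open Literature.MathematicalPhysics.QuantumFieldTheory in
/-- ★★★ **`U(N)` on `ℤ²` (`N ≥ 1`): Class T is inhabited iff `β ≥ 0`.** -/
theorem nonempty_tiltedClassState_fin_two_iff_uN {N : ℕ} (hN : 1 ≤ N) (β : ℝ) :
    Nonempty (TiltedClassState 2 (0 : Fin 2) 1 (unitaryFundamentalRep (Fin N) ℂ) β) ↔ 0 ≤ β := by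
  haveI : NeZero N := ⟨by omega⟩
  haveI : SecondCountableTopology (Matrix.unitaryGroup (Fin N) ℂ) :=
    IsUnitaryModel.secondCountableTopology _ (isUnitaryModel_unitaryFundamentalRep N)
  obtain ⟨z, hz, -⟩ := IsUnitaryModel.exists_central (unitaryFundamentalRep (Fin N) ℂ)
    (isUnitaryModel_unitaryFundamentalRep N)
  have hz' : unitaryFundamentalRep (Fin N) ℂ z = (-1 : ℂ) • (1 : Matrix (Fin N) (Fin N) ℂ) := by
    rw [hz, neg_one_smul]
  exact nonempty_tiltedClassState_two_iff (unitaryFundamentalRep (Fin N) ℂ) Fin.zero_ne_one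
    (fun k => by fin_cases k <;> simp) (continuous_unitaryFundamentalRep (Fin N) ℂ) hz'
    (by norm_num) β

end

end TiltedRP

end Summit.QuantumFields.GaugeBoot
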